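import Summits.Ventures.QEC.Census.CertScan
import HarnessLib

/-!
# Distance certificates for CSS codes: the Lean-side format `DistCert`, the checker `checkDistCert`,
# and its soundness

This is the kernel end of the LADDER-QEC certificate pipeline (plan/CERT-FORMAT.md v1/v1.1, §3–§7): a distance
certificate for a CSS code given by explicit check matrices `H^X`, `H^Z` (rows as binary numerals = bitmasks over
the `n` qubits, bit `j` = qubit `j`) consists of, per side (`Z`: syndromes by `H^X`, stabilizers from `H^Z`;
`X`: roles exchanged),

* an UPPER witness (§3 `upper`): a logical operator `v` of weight `d` together with a non-membership witness `u`
  (`H_stab u = 0`, `|u ∩ v|` odd ⇒ `v ∉ rowspace H_stab`; lemma L2 = type-02's `not_mem_rowSpace_of_witness`);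
* a LOWER-BOUND section (§3 `lower`, method `bruteforce`, §5.1): the claim "every vector of weight `1 … d−1` with
  zero syndrome is an explicit product of stabilizer rows", which the checker RE-DERIVES by its own enumeration
  (`scan` of `Census/CertScan.lean`) against the certificate's allow-list of row decompositions (lemma L3).

`DistCert.checkDistCert : DistCert → Bool` is pure `List`/`Nat`/bitwise structural recursion, so that
`checkDistCert c = true` is closed by `decide` (tier KERNEL = CERTIFIED) or `native_decide` (tier COMPILED =
CHECKED-native: adds the axiom `Lean.ofReduceBool`, flagged in the file, never counted as certified) —
plan/CERT-REQS.md §2, director D3. The checker never trusts a solver or the certificate's producer.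

SOUNDNESS (proved once, here): with `c.code hc : CSSCode (Fin |HX|) (Fin |HZ|) (Fin n)` the CSS code of type-02's
`Literature.InformationTheory.QuantumCodes.CSSCode` with check matrices `rowMatrix n HX`, `rowMatrix n HZ`
(commutation `hc` read off the check),
* monolithic: `checkDistCert c = true → (c.code _).dZ = c.dZ ∧ (c.code _).dX = c.dX` (`dZ_code`, `dX_code`);
* chunked (§7, chunk key = (side, smallest qubit of the support)): `checkStructure c = true` and
  `∀ i < n, c.chunkZ i = true` give `(c.code _).dZ = c.dZ` (`dZ_code_of_chunks`; `X` alike), each chunk its own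
  `decide`d theorem, assembled by `interval_cases`.
The printed `d = min dX dZ` then follows from type-02's `cssMinDist_eq_min_dX_dZ`.

What is NOT here (next files, same interface): the rank certificate for `k` (§3 `k_cert`, lemma L0), the
Brouwer–Zimmermann (`bz`) and meet-in-the-middle (`mitm`) methods (§5), kernel B (SAT/LRAT, type-11),
automorphism-orbit reduction (type-12), the O1 re-derivation of BB matrices from `(ℓ, m, A, B)` (type-05 bridge).
-/

namespace Summit.Ventures.QEC.Census

open Matrix Literature.InformationTheory.QuantumCodes

/-! ## The checks -/

/-- The leaf test of the brute-force method: nonzero syndrome, or the empty word, or an allow-listed word. -/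
def leafTest (allow : List ℕ) (v s : ℕ) : Bool := !(s == 0) || v == 0 || allow.elem v

/-- `foundOK Hstab found`: every allow-list entry `(v, sel)` is the XOR of the rows `Hstab[i]`, `i ∈ sel` (so it is
a stabilizer; CERT-FORMAT §4 O6 (a)). (definition) -/
def foundOK (Hstab : List ℕ) (found : List (ℕ × List ℕ)) : Bool := found.all fun e => xorRows Hstab e.2 == e.1

/-- `lowerOK n Hsyn Hstab wmax found`: the allow-list decompositions check (O6 (a)) and the brute-force replay: every
word of weight `1 … wmax` on qubits `< n` has nonzero `Hsyn`-syndrome or is allow-listed (O6 (b), method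
`bruteforce`, one `scan`). (definition) -/
def lowerOK (n : ℕ) (Hsyn Hstab : List ℕ) (wmax : ℕ) (found : List (ℕ × List ℕ)) : Bool :=
  foundOK Hstab found && scan (leafTest (found.map Prod.fst)) (posList n Hsyn) wmax 0 0

/-- Chunk `i` of the brute-force replay with total budget `b + 1`: the supports whose smallest qubit is `i`, i.e. the
scan of budget `b` over the qubits after `i` starting from the word / syndrome of qubit `i` (CERT-FORMAT §7 chunk
key (side, smallest index)). (definition) -/
def lowerChunk (n : ℕ) (Hsyn : List ℕ) (allow : List ℕ) (b i : ℕ) : Bool :=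
  scan (leafTest allow) ((posList n Hsyn).drop (i + 1)) b (2 ^ i) (colMask Hsyn i)

/-- `upperOK n Hsyn Hstab d v u`: `v` has zero `Hsyn`-syndrome and weight `d` (on qubits `< n`), and `u` has zero
`Hstab`-syndrome and odd overlap with `v` (so `v ∉ rowspace Hstab`: CERT-FORMAT §4 O5, lemma L2). (definition) -/
def upperOK (n : ℕ) (Hsyn Hstab : List ℕ) (d v u : ℕ) : Bool :=
  synZero n Hsyn v && (popc n v == d) && synZero n Hstab u && (popc n (u &&& v) % 2 == 1)

/-- `commOK n HX HZ`: every `X`-row meets every `Z`-row evenly (CERT-FORMAT §4 O2). (definition) -/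
def commOK (n : ℕ) (HX HZ : List ℕ) : Bool := HX.all fun hx => synZero n HZ hx

/-! ## The certificate -/

/-- One side (`Z` or `X`) of a distance certificate: claimed distance `d`, the upper witness `(witness, nonmember)`,
and the lower-bound allow-list `found` = pairs (word, indices of stabilizer rows XOR-ing to it). Mirrors CERT-FORMAT
§3 `upper.witness_S` + `lower.S` (method `bruteforce`, `wmax = d − 1`) minus informational fields. -/
structure SideCert where
  /-- claimed distance of this side -/
  d : ℕ
  /-- upper witness: a logical operator of weight `d` (bitmask over qubits) -/
  witness : ℕ
  /-- non-membership witness `u`: zero stabilizer-side syndrome, odd overlap with `witness` -/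
  nonmember : ℕ
  /-- allow-list: every zero-syndrome word of weight `≤ d − 1`, with its stabilizer-row decomposition -/
  found : List (ℕ × List ℕ)

/-- A distance certificate for an explicit CSS code (CERT-FORMAT v1 §3, kernel-relevant fields): `n` qubits, check
rows `HX`, `HZ` as binary numerals over the qubits (bit `j` = qubit `j`), and the two sides. The `Z` side concerns
`Z`-type operators: syndrome matrix `HX`, stabilizer matrix `HZ`; the `X` side has the roles exchanged. -/
structure DistCert where
  /-- number of qubits -/
  n : ℕ
  /-- `X`-type check rows (supports as bitmasks) -/
  HX : List ℕ
  /-- `Z`-type check rows (supports as bitmasks) -/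
  HZ : List ℕ
  /-- the `Z`-distance side (syndromes by `HX`, stabilizers from `HZ`) -/
  sideZ : SideCert
  /-- the `X`-distance side (syndromes by `HZ`, stabilizers from `HX`) -/
  sideX : SideCert

namespace DistCert

/-- The claimed `Z`-distance. -/
abbrev dZ (c : DistCert) : ℕ := c.sideZ.d

/-- The claimed `X`-distance. -/
abbrev dX (c : DistCert) : ℕ := c.sideX.d

/-- Check of one side against (syndrome rows, stabilizer rows): upper witness and brute-force lower bound. -/
def sideOK (n : ℕ) (Hsyn Hstab : List ℕ) (s : SideCert) : Bool :=
  upperOK n Hsyn Hstab s.d s.witness s.nonmember && lowerOK n Hsyn Hstab (s.d - 1) s.found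

/-- **The checker** (monolithic): commutation (O2), and for each side the upper witness (O5) and the replayed
brute-force lower bound against the allow-list (O6). Close `checkDistCert c = true` by `decide` (KERNEL tier) or
`native_decide` (COMPILED tier, flagged). -/
def checkDistCert (c : DistCert) : Bool :=
  commOK c.n c.HX c.HZ && sideOK c.n c.HX c.HZ c.sideZ && sideOK c.n c.HZ c.HX c.sideX

/-- The structural part of the check (everything except the two replays): commutation, both upper witnesses, both
allow-list decompositions. Used with the chunked replays `chunkZ` / `chunkX`. -/
def checkStructure (c : DistCert) : Bool :=
  commOK c.n c.HX c.HZ && upperOK c.n c.HX c.HZ c.sideZ.d c.sideZ.witness c.sideZ.nonmember &&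
    foundOK c.HZ c.sideZ.found && upperOK c.n c.HZ c.HX c.sideX.d c.sideX.witness c.sideX.nonmember &&
    foundOK c.HX c.sideX.found

/-- Chunk `i < n` of the `Z`-side replay (supports of weight `≤ dZ − 1` whose smallest qubit is `i`). -/
def chunkZ (c : DistCert) (i : ℕ) : Bool := lowerChunk c.n c.HX (c.sideZ.found.map Prod.fst) (c.dZ - 2) i

/-- Chunk `i < n` of the `X`-side replay (supports of weight `≤ dX − 1` whose smallest qubit is `i`). -/
def chunkX (c : DistCert) (i : ℕ) : Bool := lowerChunk c.n c.HZ (c.sideX.found.map Prod.fst) (c.dX - 2) i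

end DistCert

/-! ## Soundness of the checks -/

section Soundness

variable {n : ℕ} {Hsyn Hstab : List ℕ}

/-- The commutation check gives `H^X (H^Z)ᵀ = 0` for the row-list matrices. -/
theorem comm_of_commOK {HX HZ : List ℕ} (h : commOK n HX HZ = true) :
    rowMatrix n HX * (rowMatrix n HZ)ᵀ = 0 := by
  ext i j
  change ofBits n HX[i] ⬝ᵥ ofBits n HZ[j] = 0
  simp only [commOK, synZero, List.all_eq_true, beq_iff_eq] at h
  rw [ofBits_dotProduct, natCast_zmod2_eq_zero_iff, Nat.and_comm]
  exact h _ (List.getElem_mem i.2) _ (List.getElem_mem j.2)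

/-- **Upper bound (L2)**: a passing upper witness is a logical operator of weight `d` outside the stabilizer row
space. -/
theorem upper_sound {d v u : ℕ} (h : upperOK n Hsyn Hstab d v u = true) :
    rowMatrix n Hsyn *ᵥ ofBits n v = 0 ∧ ofBits n v ∉ rowSpace (rowMatrix n Hstab) ∧
      hammingNorm (ofBits n v) = d := by
  simp only [upperOK, Bool.and_eq_true, beq_iff_eq] at h
  obtain ⟨⟨⟨hv, hwt⟩, hu⟩, huv⟩ := h
  refine ⟨(synZero_iff _ _ _).1 hv, ?_, by rw [hammingNorm_ofBits, hwt]⟩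
  refine not_mem_rowSpace_of_witness (ofBits n u) ((synZero_iff _ _ _).1 hu) ?_
  rw [ofBits_dotProduct, natCast_zmod2_ne_zero_iff]
  exact huv

/-- **Lower bound (L3)**: if the allow-list decomposes over the stabilizer rows and the replay of budget `wmax`
reached every support, then every logical operator (zero syndrome, outside the stabilizer row space) has weight
`> wmax`. -/
theorem lower_sound {wmax : ℕ} {found : List (ℕ × List ℕ)} (hfound : foundOK Hstab found = true)
    (hreach : Reaches (leafTest (found.map Prod.fst)) (posList n Hsyn) wmax 0 0) (w : Fin n → ZMod 2)
    (hw : rowMatrix n Hsyn *ᵥ w = 0) (hw' : w ∉ rowSpace (rowMatrix n Hstab)) : wmax < hammingNorm w := by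
  simp only [foundOK, List.all_eq_true, beq_iff_eq] at hfound
  by_contra hle
  rw [not_lt] at hle
  have hS := hreach (suppList n Hsyn w) (suppList_sublist n Hsyn w) (by rw [length_suppList]; exact hle)
  rw [Nat.zero_xor, Nat.zero_xor, xorSnd_suppList_eq_zero n Hsyn w hw, leafTest] at hS
  simp only [beq_self_eq_true, Bool.not_true, Bool.false_or, Bool.or_eq_true, beq_iff_eq] at hS
  rcases hS with h0 | hmem
  · apply hw'
    rw [← ofBits_xorFst_suppList n Hsyn w, h0, ofBits_zero]
    exact Submodule.zero_mem _
  · apply hw'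
    rw [← ofBits_xorFst_suppList n Hsyn w]
    obtain ⟨e, he, hex⟩ : ∃ e ∈ found, e.1 = xorFst (suppList n Hsyn w) := by
      simpa [List.mem_map] using List.mem_of_elem_eq_true hmem
    rw [← hex, ← hfound e he]
    exact ofBits_xorRows_mem_rowSpace n Hstab e.2

/-- The chunked replay: the `n` first-index chunks of budget `b` give the full replay of budget `b + 1` from the
empty word (the empty word itself passes `leafTest`). -/
theorem reaches_of_lowerChunks {allow : List ℕ} {b : ℕ}
    (h : ∀ i : ℕ, i < n → lowerChunk n Hsyn allow b i = true) :
    Reaches (leafTest allow) (posList n Hsyn) (b + 1) 0 0 := by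
  refine reaches_of_chunks _ b 0 0 (by simp [leafTest]) fun i hi => ?_
  have hin : i < n := by simpa [posList] using hi
  have hget : (posList n Hsyn)[i] = (2 ^ i, colMask Hsyn i) := by simp [posList]
  rw [hget, Nat.zero_xor, Nat.zero_xor]
  exact reaches_of_scan (h i hin)

/-- Soundness of one side, monolithic form: `sideOK` gives the (witness, universal lower bound) pair of type-02's
`CSSCode.dX_eq_of_witness` for stabilizers `rowMatrix n Hstab` and syndromes `rowMatrix n Hsyn`. -/
theorem sideOK_sound {s : SideCert} (h : DistCert.sideOK n Hsyn Hstab s = true) :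
    ∃ v : Fin n → ZMod 2, rowMatrix n Hsyn *ᵥ v = 0 ∧ v ∉ rowSpace (rowMatrix n Hstab) ∧ hammingNorm v = s.d ∧
      ∀ w : Fin n → ZMod 2, rowMatrix n Hsyn *ᵥ w = 0 → w ∉ rowSpace (rowMatrix n Hstab) →
        s.d ≤ hammingNorm w := by
  simp only [DistCert.sideOK, lowerOK, Bool.and_eq_true] at h
  obtain ⟨hup, hfound, hscan⟩ := h
  obtain ⟨hv, hv', hwt⟩ := upper_sound hup
  refine ⟨ofBits n s.witness, hv, hv', hwt, fun w hw hw' => ?_⟩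
  have := lower_sound hfound (reaches_of_scan hscan) w hw hw'
  omega

/-- Soundness of one side, chunked form. -/
theorem side_sound_of_chunks {s : SideCert} (hup : upperOK n Hsyn Hstab s.d s.witness s.nonmember = true)
    (hfound : foundOK Hstab s.found = true)
    (hch : ∀ i : ℕ, i < n → lowerChunk n Hsyn (s.found.map Prod.fst) (s.d - 2) i = true) :
    ∃ v : Fin n → ZMod 2, rowMatrix n Hsyn *ᵥ v = 0 ∧ v ∉ rowSpace (rowMatrix n Hstab) ∧ hammingNorm v = s.d ∧
      ∀ w : Fin n → ZMod 2, rowMatrix n Hsyn *ᵥ w = 0 → w ∉ rowSpace (rowMatrix n Hstab) →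
        s.d ≤ hammingNorm w := by
  obtain ⟨hv, hv', hwt⟩ := upper_sound hup
  refine ⟨ofBits n s.witness, hv, hv', hwt, fun w hw hw' => ?_⟩
  have hreach : Reaches (leafTest (s.found.map Prod.fst)) (posList n Hsyn) (s.d - 1) 0 0 :=
    (reaches_of_lowerChunks hch).mono (by omega)
  have := lower_sound hfound hreach w hw hw'
  omega

end Soundness

/-! ## Soundness of the checker -/

namespace DistCert

variable (c : DistCert)

/-- The CSS code of a certificate whose commutation check passes: qubits `Fin c.n`, check matrices
`rowMatrix c.n c.HX`, `rowMatrix c.n c.HZ` (type-02's `CSSCode`; the proof argument is irrelevant to the value). -/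
def code (hc : commOK c.n c.HX c.HZ = true) : CSSCode (Fin c.HX.length) (Fin c.HZ.length) (Fin c.n) :=
  CSSCode.ofMatrices (rowMatrix c.n c.HX) (rowMatrix c.n c.HZ) (comm_of_commOK hc)

/-- A passing monolithic check includes the commutation check. -/
theorem commOK_of_check (h : c.checkDistCert = true) : commOK c.n c.HX c.HZ = true := by
  simp only [checkDistCert, Bool.and_eq_true] at h
  exact h.1.1

/-- A passing structural check includes the commutation check. -/
theorem commOK_of_checkStructure (h : c.checkStructure = true) : commOK c.n c.HX c.HZ = true := by
  simp only [checkStructure, Bool.and_eq_true] at h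
  exact h.1.1.1.1

/-- **Soundness, `Z` side**: a checked certificate's code has `Z`-distance `c.dZ`. -/
theorem dZ_code (h : c.checkDistCert = true) : (c.code (c.commOK_of_check h)).dZ = c.dZ := by
  have h' := h
  simp only [checkDistCert, Bool.and_eq_true] at h'
  obtain ⟨v, hv, hv', hwt, hall⟩ := sideOK_sound h'.1.2
  exact (c.code _).dZ_eq_of_witness hv hv' hwt hall

/-- **Soundness, `X` side**: a checked certificate's code has `X`-distance `c.dX`. -/
theorem dX_code (h : c.checkDistCert = true) : (c.code (c.commOK_of_check h)).dX = c.dX := by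
  have h' := h
  simp only [checkDistCert, Bool.and_eq_true] at h'
  obtain ⟨v, hv, hv', hwt, hall⟩ := sideOK_sound h'.2
  exact (c.code _).dX_eq_of_witness hv hv' hwt hall

/-- **Soundness, `Z` side, chunked**: structural check + all `n` `Z`-chunks give `Z`-distance `c.dZ`. -/
theorem dZ_code_of_chunks (hs : c.checkStructure = true) (hZ : ∀ i : ℕ, i < c.n → c.chunkZ i = true) :
    (c.code (c.commOK_of_checkStructure hs)).dZ = c.dZ := by
  have h' := hs
  simp only [checkStructure, Bool.and_eq_true] at h'
  obtain ⟨v, hv, hv', hwt, hall⟩ := side_sound_of_chunks (s := c.sideZ) h'.1.1.1.2 h'.1.1.2 hZ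
  exact (c.code _).dZ_eq_of_witness hv hv' hwt hall

/-- **Soundness, `X` side, chunked**: structural check + all `n` `X`-chunks give `X`-distance `c.dX`. -/
theorem dX_code_of_chunks (hs : c.checkStructure = true) (hX : ∀ i : ℕ, i < c.n → c.chunkX i = true) :
    (c.code (c.commOK_of_checkStructure hs)).dX = c.dX := by
  have h' := hs
  simp only [checkStructure, Bool.and_eq_true] at h'
  obtain ⟨v, hv, hv', hwt, hall⟩ := side_sound_of_chunks (s := c.sideX) h'.1.2 h'.2 hX
  exact (c.code _).dX_eq_of_witness hv hv' hwt hall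

end DistCert

/-! ## Control (CERT-REQS A1): the `[[4,2,2]]` code, tier KERNEL -/

/-- The `[[4,2,2]]` certificate of CERT-FORMAT §8 (kernel A, file cert/examples/C422.certA.json, transcribed
supports ↦ bitmasks): `HX = HZ = [1111]`, witnesses `Z₀Z₁` / `X₀X₂` with non-membership witnesses `{0,2}` /
`{0,1}`, brute force `wmax = 1` with empty allow-lists. (`[[4,2,2]]` is a CLAIM as printed until this check.) -/
def certC422 : DistCert where
  n := 4
  HX := [15]
  HZ := [15]
  sideZ := { d := 2, witness := 3, nonmember := 5, found := [] }
  sideX := { d := 2, witness := 5, nonmember := 3, found := [] }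

/-- The checker accepts the `[[4,2,2]]` certificate (by `decide`: tier KERNEL). -/
theorem checkDistCert_certC422 : certC422.checkDistCert = true := by decide

/-- `d_Z = 2` for the `[[4,2,2]]` code — CERTIFIED (kernel, axioms ⊆ {propext, Classical.choice, Quot.sound}). -/
theorem dZ_certC422 : (certC422.code (certC422.commOK_of_check checkDistCert_certC422)).dZ = 2 :=
  certC422.dZ_code checkDistCert_certC422

/-- `d_X = 2` for the `[[4,2,2]]` code — CERTIFIED. -/
theorem dX_certC422 : (certC422.code (certC422.commOK_of_check checkDistCert_certC422)).dX = 2 :=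
  certC422.dX_code checkDistCert_certC422

end Summit.Ventures.QEC.Census
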